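import Summits.HodgeConjecture.HodgeConjecture.Theorems.K2E1IntertwiningScalarEulerProductU2     -- ★ spherical template `localMean_eq_eulerFactor`; brings ★ `K2E1IntertwiningLocalFactorU2Line` (`P_v` token, `prod_extension_max_one_eq_sq∕_eq_one_of_mem_integers`), ★ `K2E1IntertwiningLocalFactorU2`, ★ `K2LiuGKRankOneIntegral` (shells)
import Summits.HodgeConjecture.HodgeConjecture.Theorems.K2E3HC14EllU11Orbit                  -- ★ `antidiagonal_two_over_eq` (`Φ₂ = !![0,1;1,0]` over any commutative ring); brings ★ `unitaryGroupOfForm`, `mem_unitaryGroupOfForm_iff`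
import HarnessLib

/-!
# K2·E1 ∕ R90·S8 — `K2E1ChiLocalWeightNonsplitU2` (J2′-2-NONSPLIT, FILE 1): the Iwasawa torus part of `w₀ · n(x)` in `U(σ, J₂)` (ring-generic) and the
# `χ`-weighted local mean of a shell-geometric weight = E1's local `χ`-scalar `(1 − e q_v^{−2z})(1 − e q_v^{−(2z−1)})⁻¹` (letter (T) of J2′-1)

Cell `pub/hodgecm-mathlib`, crux h413 = `stmt-HodgeConjecture-24833`, route of record `HCCMUnconditional`; R90-TF section S8 «ContSpec-n½», KYS ∕ #2 road, deal S8-R19 ∕ S8-R22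
(R90-CS-plan (g2)) «J2′-2-NONSPLIT» to R90-C10-p07 (g0); census `R90/S8/CENSUS-J2p2-nonsplit.R90-C10-p07-g0.md` 1e206715b4c3fddc «=».  THEOREMS ONLY (no `def`, no `instance`,
no notation, no named-fact hypothesis, no `sorry`; default heartbeats); lane `--supports stmt-HodgeConjecture-24833 --as helper` (count-neutral; closes no socket).

WHAT.  The letters of the J2′-1 hand (K2E1-p13 (g4), `Theorems/K2E1ChiIntertwiningScalarEulerProductU2.lean`, HEADS v1 16:48:14Z) are (ω) local weights `ω_v : L⁺_v → ℂ`
(continuous, `‖ω_v‖ ≤ 1`, `= 1` on `𝒪_v` off `S`), (W) the factorisation of the `χ`-section along the big-cell line `w₀·n(θ t)`, and (T) the unramified token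
`(ν_v 𝒪_v)⁻¹ ∫ ω_v · P_v^{−z} dν_v = (1 − ε_v q_v^{−2z})(1 − ε_v q_v^{−(2z−1)})⁻¹`.  This file supplies the two LOCAL facts behind them at a NON-SPLIT place:
* §1 (RING-GENERIC, any commutative ring `R` with involution `σ`, any unit `x` with `σ x = −x`): the explicit big-cell identity
  `J₂ · n(x) = n(x⁻¹) · diag(−x⁻¹, x) · k(x)`, `k(x) = (1 0; x⁻¹ 1)` (`antidiag_mul_lineUnipotent_eq`), the memberships of `n(y)`, `k(c)`, `diag(a,b)`, `J₂` in `U(σ, J₂)(R)`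
  (`lineUnipotent_mem_iff`, `lowerUnipotent_mem_iff`, `diag_mem_iff`, `antidiag_mem`), and the packaged decomposition **`exists_borel_mul_lower_eq_weyl_mul_lineUnipotent`**:
  `w·n = b·k` with `b = (−x⁻¹ 1; 0 x)` upper triangular (FIRST TORUS ENTRY `−x⁻¹`) and `k = (1 0; x⁻¹ 1)`, both in `U(σ, J₂)(R)`.  Over `L⁺_v` with `|x|_w ≥ 1` this IS the
  Iwasawa decomposition of `w₀ n(x)` (`k` integral); the torus entry `−x⁻¹ = −(ι_w t · δ)⁻¹` is K2Liu's `det_Δ(p)_w` (★ `K2LiuGKRankOneValue.detDelta_factor`) in E1's own frame —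
  the «Iwasawa torus part of `w₀·n(x)`» of letter (W), place-type-free (the J2′-2-SPLIT hand imports it by name).
* §3 ((T), hypothesis-first in the weight): **`chiLocalMean_eq_chiLocalScalar_of_shells`** — at a finite place `v` with `‖δ‖_w = 1` (`w ∣ v`), for `½ < Re z`, `‖e‖ ≤ 1` and a weight
  `ω_v` that is `1` on `𝒪_v` and `e^{m+1}` on the sphere `‖t‖_v = q_v^{m+1}`: `t ↦ ω_v(t)·P_v(t)^{−z}` is integrable and
  `ν_v(𝒪_v)⁻¹ ∫ ω_v·P_v^{−z} dν_v = (1 − e·q_v^{−2z})·(1 − e·q_v^{−(2z−1)})⁻¹` in the integrand BYTES of ★ `K2E1ChiIntertwiningLocalFactorHolomorphicU2.differentiableOn_chiLocalMean`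
  and the token bytes of ★ `K2E1ChiIntertwiningScalarEulerQuotientU2.hasProd_chiLocalScalar` (`e := ε.valueAtUniformizer v`) — ★ `K2LiuGKRankOneIntegral.integrable_and_integral_eq_of_shells`
  (parameter `τ = e·q_v^{−2z}`, `‖τ‖ ≤ q_v^{−2Re z} < q_v⁻¹`) + ★ `prod_extension_max_one_eq_sq` ∕ `…_eq_one_of_mem_integers` (`P_v = max(1,‖·‖_v)²` off `S_δ`).  At a NON-SPLIT
  unramified `v` the Iwasawa weight of §1 (`χ_w(−(ι_w t·δ)⁻¹)` off `𝒪_v`, `1` on `𝒪_v`, `χ_w` unramified) has exactly this shape with `e = χ_w(ι_w ϖ_v)` (FILE 2 of this hand);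
  the spherical case `e = 1`, `ω ≡ 1` is ★ `K2E1IntertwiningScalarEulerProductU2.localMean_eq_eulerFactor`.
HONEST LABEL: HC_CM is proved only modulo the 7 printed citations (2 remaining named inputs: hLiu418 = `stmt-HodgeConjecture-24832`, h413 = `stmt-HodgeConjecture-24833`) until rung 0
closes; REL ≠ ★ ≠ BUILT; this file asserts no named fact and closes no socket; count-neutral.

## References
* [MoeglinWaldspurger1995] C. Mœglin, J.-L. Waldspurger, *Spectral Decomposition and Eisenstein Series* (1995), I.2.2 (big cell), II.1.6 (local intertwining integrals).
* [Casselman1980] W. Casselman, *The unramified principal series of p-adic groups I*, Compositio Math. 40 (1980), §3 Thm. 3.1.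
* [Langlands1976] R. P. Langlands, *On the Functional Equations Satisfied by Eisenstein Series*, LNM 544 (1976), Appendix.
* [Rogawski1990] J. D. Rogawski, *Automorphic Representations of Unitary Groups in Three Variables* (1990), §1.9–§1.10 pp. 8–9 (`U(Φ₂)`, `B = TN`, `w₀`), §13.9 p. 229.
-/

set_option autoImplicit false
set_option linter.dupNamespace false

noncomputable section

namespace Summit.HodgeConjecture.HodgeConjecture.Cruxes.H413.K2E1ChiLocalWeightNonsplitU2

open Literature.NumberTheory.Automorphic Literature.NumberTheory.Automorphic.UnitaryGroup
open scoped Matrix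

section RingGeneric

variable {R : Type*} [CommRing R] (σ : R →+* R)

/-- **THE BIG-CELL IWASAWA IDENTITY IN `GL₂`, ring-generic**: for a unit `x`,
`(0 1; 1 0)·(1 x; 0 1) = (1 x⁻¹; 0 1)·(−x⁻¹ 0; 0 x)·(1 0; x⁻¹ 1)` (both sides are `(0 1; 1 x)`). [cite: MoeglinWaldspurger1995, I.2.2] [folklore] -/
theorem antidiag_mul_lineUnipotent_eq (x : Rˣ) :
    (!![(0 : R), 1; 1, 0] * !![1, (x : R); 0, 1] : Matrix (Fin 2) (Fin 2) R) =
      !![1, ((x⁻¹ : Rˣ) : R); 0, 1] * !![-((x⁻¹ : Rˣ) : R), 0; 0, (x : R)] * !![1, 0; ((x⁻¹ : Rˣ) : R), 1] := by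
  have hx : ((x⁻¹ : Rˣ) : R) * (x : R) = 1 := by rw [← Units.val_mul, inv_mul_cancel, Units.val_one]
  have hx' : (x : R) * ((x⁻¹ : Rˣ) : R) = 1 := by rw [← Units.val_mul, mul_inv_cancel, Units.val_one]
  ext i j
  fin_cases i <;> fin_cases j <;>
    simp [Matrix.mul_apply, Fin.sum_univ_two, Matrix.cons_val_zero, Matrix.cons_val_one, Matrix.head_cons, hx, hx']

/-- `n(y) = (1 y; 0 1) ∈ U(σ, Φ₂)(R)` iff `σ y + y = 0`. [cite: Rogawski1990, §1.9 p. 8] -/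
theorem lineUnipotent_mem_iff {y : R} {u : GL (Fin 2) R} (hu : (u : Matrix (Fin 2) (Fin 2) R) = !![1, y; 0, 1]) :
    u ∈ unitaryGroupOfForm σ ((StdForm.antidiagonal 2).over R) ↔ σ y + y = 0 := by
  rw [mem_unitaryGroupOfForm_iff, hu, K2E3HC14EllU11Orbit.antidiagonal_two_over_eq]
  constructor
  · intro h
    have h01 := congrArg (fun M : Matrix (Fin 2) (Fin 2) R => M 1 1) h
    rw [add_comm]
    simpa [Matrix.mul_apply, Fin.sum_univ_two, Matrix.map_apply] using h01
  · intro h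
    rw [add_comm] at h
    ext i j
    fin_cases i <;> fin_cases j <;>
      simp [Matrix.mul_apply, Fin.sum_univ_two, Matrix.map_apply, h]

/-- `k(c) = (1 0; c 1) ∈ U(σ, Φ₂)(R)` iff `σ c + c = 0`. [cite: Rogawski1990, §1.9 p. 8] -/
theorem lowerUnipotent_mem_iff {c : R} {u : GL (Fin 2) R} (hu : (u : Matrix (Fin 2) (Fin 2) R) = !![1, 0; c, 1]) :
    u ∈ unitaryGroupOfForm σ ((StdForm.antidiagonal 2).over R) ↔ σ c + c = 0 := by
  rw [mem_unitaryGroupOfForm_iff, hu, K2E3HC14EllU11Orbit.antidiagonal_two_over_eq]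
  constructor
  · intro h
    have h00 := congrArg (fun M : Matrix (Fin 2) (Fin 2) R => M 0 0) h
    simpa [Matrix.mul_apply, Fin.sum_univ_two, Matrix.map_apply] using h00
  · intro h
    ext i j
    fin_cases i <;> fin_cases j <;>
      simp [Matrix.mul_apply, Fin.sum_univ_two, Matrix.map_apply, h]

/-- `diag(a, b) ∈ U(σ, Φ₂)(R)` iff `σ a · b = 1` and `σ b · a = 1`. [cite: Rogawski1990, §1.9 p. 8] -/
theorem diag_mem_iff {a b : R} {u : GL (Fin 2) R} (hu : (u : Matrix (Fin 2) (Fin 2) R) = !![a, 0; 0, b]) :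
    u ∈ unitaryGroupOfForm σ ((StdForm.antidiagonal 2).over R) ↔ σ a * b = 1 ∧ σ b * a = 1 := by
  rw [mem_unitaryGroupOfForm_iff, hu, K2E3HC14EllU11Orbit.antidiagonal_two_over_eq]
  constructor
  · intro h
    have h01 := congrArg (fun M : Matrix (Fin 2) (Fin 2) R => M 0 1) h
    have h10 := congrArg (fun M : Matrix (Fin 2) (Fin 2) R => M 1 0) h
    simp [Matrix.mul_apply, Fin.sum_univ_two, Matrix.map_apply] at h01 h10
    exact ⟨h01, h10⟩
  · rintro ⟨h1, h2⟩
    ext i j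
    fin_cases i <;> fin_cases j <;>
      simp [Matrix.mul_apply, Fin.sum_univ_two, Matrix.map_apply, h1, h2]

/-- `J₂ = (0 1; 1 0) ∈ U(σ, Φ₂)(R)` (the long Weyl element is the form matrix itself; `σ 0 = 0`, `σ 1 = 1`). [cite: Rogawski1990, §1.10 p. 9] -/
theorem antidiag_mem {w : GL (Fin 2) R} (hw : (w : Matrix (Fin 2) (Fin 2) R) = !![0, 1; 1, 0]) :
    w ∈ unitaryGroupOfForm σ ((StdForm.antidiagonal 2).over R) := by
  rw [mem_unitaryGroupOfForm_iff, hw, K2E3HC14EllU11Orbit.antidiagonal_two_over_eq]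
  ext i j
  fin_cases i <;> fin_cases j <;> simp [Matrix.mul_apply, Fin.sum_univ_two, Matrix.map_apply]

/-- `σ(x⁻¹) = −x⁻¹` for a unit `x` with `σ x = −x`. [folklore] -/
theorem map_units_inv_eq_neg (x : Rˣ) (hx : σ x = -(x : R)) : σ ((x⁻¹ : Rˣ) : R) = -((x⁻¹ : Rˣ) : R) := by
  have h1 : σ ((x⁻¹ : Rˣ) : R) * (x : R) = -1 := by
    have h := congrArg σ (show ((x⁻¹ : Rˣ) : R) * (x : R) = 1 by rw [← Units.val_mul, inv_mul_cancel, Units.val_one])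
    rw [map_mul, map_one, hx, mul_neg] at h
    rw [← neg_eq_iff_eq_neg.mpr h.symm]
  calc σ ((x⁻¹ : Rˣ) : R) = σ ((x⁻¹ : Rˣ) : R) * (x : R) * ((x⁻¹ : Rˣ) : R) := by
        rw [mul_assoc, ← Units.val_mul, mul_inv_cancel, Units.val_one, mul_one]
    _ = -((x⁻¹ : Rˣ) : R) := by rw [h1, neg_one_mul]

/-- **THE IWASAWA DECOMPOSITION OF `w₀ · n(x)` ON THE BIG CELL OF `U(σ, J₂)`, ring-generic and explicit.**  For a unit `x` with `σ x = −x` and `w, n ∈ GL₂(R)` with matrices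
`(0 1; 1 0)`, `(1 x; 0 1)`: `w · n = b · k` with `b = (−x⁻¹ 1; 0 x)` UPPER TRIANGULAR (first torus entry `−x⁻¹`, `= n(x⁻¹)·diag(−x⁻¹, x)`) and `k = (1 0; x⁻¹ 1)`, BOTH in `U(σ, J₂)(R)`.
Over a local field with `|x| ≥ 1`, `k` is integral: this is the Iwasawa decomposition, torus part `diag(−x⁻¹, x)` (K2Liu's `det_Δ = −x⁻¹` at rank one, ★ `K2LiuGKRankOneValue.detDelta_factor`).
[cite: MoeglinWaldspurger1995, I.2.2] [cite: Rogawski1990, §1.10 p. 9] -/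
theorem exists_borel_mul_lower_eq_weyl_mul_lineUnipotent (x : Rˣ) (hx : σ x = -(x : R)) {w n : GL (Fin 2) R}
    (hw : (w : Matrix (Fin 2) (Fin 2) R) = !![0, 1; 1, 0]) (hn : (n : Matrix (Fin 2) (Fin 2) R) = !![1, (x : R); 0, 1]) :
    ∃ b k : GL (Fin 2) R,
      (b : Matrix (Fin 2) (Fin 2) R) = !![-((x⁻¹ : Rˣ) : R), 1; 0, (x : R)] ∧ (k : Matrix (Fin 2) (Fin 2) R) = !![1, 0; ((x⁻¹ : Rˣ) : R), 1] ∧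
      b ∈ unitaryGroupOfForm σ ((StdForm.antidiagonal 2).over R) ∧ k ∈ unitaryGroupOfForm σ ((StdForm.antidiagonal 2).over R) ∧
      w * n = b * k := by
  -- `k` and its inverse
  have hk1 : (!![1, 0; ((x⁻¹ : Rˣ) : R), 1] : Matrix (Fin 2) (Fin 2) R) * !![1, 0; -((x⁻¹ : Rˣ) : R), 1] = 1 := by
    ext i j; fin_cases i <;> fin_cases j <;> simp [Matrix.mul_apply, Fin.sum_univ_two]
  have hk2 : (!![1, 0; -((x⁻¹ : Rˣ) : R), 1] : Matrix (Fin 2) (Fin 2) R) * !![1, 0; ((x⁻¹ : Rˣ) : R), 1] = 1 := by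
    ext i j; fin_cases i <;> fin_cases j <;> simp [Matrix.mul_apply, Fin.sum_univ_two]
  let k : GL (Fin 2) R := ⟨_, _, hk1, hk2⟩
  have hkU : k ∈ unitaryGroupOfForm σ ((StdForm.antidiagonal 2).over R) :=
    (lowerUnipotent_mem_iff σ (u := k) rfl).2 (by rw [map_units_inv_eq_neg σ x hx, neg_add_cancel])
  have hnU : n ∈ unitaryGroupOfForm σ ((StdForm.antidiagonal 2).over R) :=
    (lineUnipotent_mem_iff σ hn).2 (by rw [hx, neg_add_cancel])
  have hwU : w ∈ unitaryGroupOfForm σ ((StdForm.antidiagonal 2).over R) := antidiag_mem σ hw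
  refine ⟨w * n * k⁻¹, k, ?_, rfl, Subgroup.mul_mem _ (Subgroup.mul_mem _ hwU hnU) (Subgroup.inv_mem _ hkU), hkU,
    by rw [inv_mul_cancel_right]⟩
  -- the matrix of `b = w n k⁻¹ = n(x⁻¹) · diag(−x⁻¹, x)`
  have hb : (!![1, ((x⁻¹ : Rˣ) : R); 0, 1] * !![-((x⁻¹ : Rˣ) : R), 0; 0, (x : R)] : Matrix (Fin 2) (Fin 2) R) =
      !![-((x⁻¹ : Rˣ) : R), 1; 0, (x : R)] := by
    have hx' : ((x⁻¹ : Rˣ) : R) * (x : R) = 1 := by rw [← Units.val_mul, inv_mul_cancel, Units.val_one]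
    ext i j; fin_cases i <;> fin_cases j <;> simp [Matrix.mul_apply, Fin.sum_univ_two, hx']
  rw [Units.val_mul, Units.val_mul, hw, hn, antidiag_mul_lineUnipotent_eq, Matrix.mul_assoc (_ * _),
    show ((!![1, 0; ((x⁻¹ : Rˣ) : R), 1] : Matrix (Fin 2) (Fin 2) R) * ((k⁻¹ : GL (Fin 2) R) : Matrix (Fin 2) (Fin 2) R)) = 1 from hk1, Matrix.mul_one, hb]

end RingGeneric

/-! ## §3 (T) at an unramified place: the `χ`-weighted local mean of a SHELL-GEOMETRIC weight is E1's local `χ`-scalar -/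

section Shells

open MeasureTheory Measure NumberField IsDedekindDomain IsDedekindDomain.HeightOneSpectrum Set
open scoped NNReal ENNReal
open Literature.NumberTheory.GaloisRepresentations.IsNonarchimedeanLocalField Literature.NumberTheory.Automorphic.LocalFieldHaar
open Summit.HodgeConjecture.HodgeConjecture.Cruxes.H413.K2E1IntertwiningLocalFactorU2Line
open Summit.HodgeConjecture.HodgeConjecture.Cruxes.HLiu418.K2LiuGKRankOneIntegral (one_lt_residueFieldCard_real integrable_and_integral_eq_of_shells coe_normAbs_of_mem_outerShell)

variable (L : Type) [Field L] [NumberField L] [IsCMField L] {δ : L}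

/-- **(T) — THE `χ`-WEIGHTED LOCAL MEAN AT AN UNRAMIFIED PLACE IS E1's LOCAL `χ`-SCALAR.**  Let `v` be a finite place of `L⁺` with `‖δ‖_w = 1` for all `w ∣ v`, `μ` an additive Haar measure on
`L⁺_v`, `½ < Re z`, `‖e‖ ≤ 1`, and `ω : L⁺_v → ℂ` a weight which is `1` on `𝒪_v` and equals `e^{m+1}` on the sphere `‖t‖_v = q_v^{m+1}` (the shape of the Iwasawa weight
`χ_w(−(ι_w t·δ)⁻¹)` for unramified `χ_w` at a NON-SPLIT `v`, `e = χ_w(ι_w ϖ_v) = ε.valueAtUniformizer v`; §4).  Then `t ↦ ω(t)·P_v(t)^{−z}` is integrable and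
`μ(𝒪_v)⁻¹ · ∫ ω·P_v^{−z} dμ = (1 − e·q_v^{−2z})·(1 − e·q_v^{−(2z−1)})⁻¹` — the `v`-factor of ★ `K2E1ChiIntertwiningScalarEulerQuotientU2.hasProd_chiLocalScalar`, in the integrand
bytes of ★ `K2E1ChiIntertwiningLocalFactorHolomorphicU2.differentiableOn_chiLocalMean` (`P_v(t) = ∏_{w∣v} max(1, ‖ι_w t‖_w‖δ‖_w) = max(1,‖t‖_v)²`, ★ `prod_extension_max_one_eq_sq`).
Shell engine ★ `K2LiuGKRankOneIntegral.integrable_and_integral_eq_of_shells` with parameter `τ = e·q_v^{−2z}`, `‖τ‖ ≤ q_v^{−2 Re z} < q_v⁻¹`.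
[cite: Casselman1980, §3 Thm. 3.1] [cite: Langlands1976, Appendix] [cite: Rogawski1990, §13.9 p. 229] -/
theorem chiLocalMean_eq_chiLocalScalar_of_shells (v : HeightOneSpectrum (𝓞 ↥(maximalRealSubfield L)))
    [MeasurableSpace (v.adicCompletion ↥(maximalRealSubfield L))] [BorelSpace (v.adicCompletion ↥(maximalRealSubfield L))]
    (μ : Measure (v.adicCompletion ↥(maximalRealSubfield L))) [μ.IsAddHaarMeasure]
    (hv : ∀ w : v.Extension (𝓞 L), normAbs (w.1.adicCompletion L) ((algebraMap L (FiniteAdeleRing (𝓞 L) L) δ) w.1) = 1)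
    {e : ℂ} (he : ‖e‖ ≤ 1) {z : ℂ} (hz : 1 / 2 < z.re)
    (ω : v.adicCompletion ↥(maximalRealSubfield L) → ℂ)
    (hω0 : ∀ t ∈ v.adicCompletionIntegers ↥(maximalRealSubfield L), ω t = 1)
    (hωS : ∀ (m : ℕ) (t : v.adicCompletion ↥(maximalRealSubfield L)),
      t ∈ primePowBall (v.adicCompletion ↥(maximalRealSubfield L)) (-((m : ℤ) + 1)) \ primePowBall (v.adicCompletion ↥(maximalRealSubfield L)) (-((m : ℤ) + 1) + 1) →
        ω t = e ^ (m + 1)) :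
    Integrable (fun t : v.adicCompletion ↥(maximalRealSubfield L) => ω t * ((((letI := Extension.fintype (𝓞 ↥(maximalRealSubfield L)) ↥(maximalRealSubfield L) L (𝓞 L) v; ∏ w : v.Extension (𝓞 L), max 1 (normAbs (w.1.adicCompletion L) (Extension.adicCompletionSemialgHom ↥(maximalRealSubfield L) L w t) * normAbs (w.1.adicCompletion L) ((algebraMap L (FiniteAdeleRing (𝓞 L) L) δ) w.1))) : ℝ≥0) : ℝ) : ℂ) ^ (-z)) μ ∧
    ((((μ (v.adicCompletionIntegers ↥(maximalRealSubfield L))).toReal⁻¹ : ℝ)) : ℂ) *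
      ∫ t : v.adicCompletion ↥(maximalRealSubfield L), ω t * ((((letI := Extension.fintype (𝓞 ↥(maximalRealSubfield L)) ↥(maximalRealSubfield L) L (𝓞 L) v; ∏ w : v.Extension (𝓞 L), max 1 (normAbs (w.1.adicCompletion L) (Extension.adicCompletionSemialgHom ↥(maximalRealSubfield L) L w t) * normAbs (w.1.adicCompletion L) ((algebraMap L (FiniteAdeleRing (𝓞 L) L) δ) w.1))) : ℝ≥0) : ℝ) : ℂ) ^ (-z) ∂μ =
    (1 - e * (v.residueCard : ℂ) ^ (-(2 * z))) * (1 - e * (v.residueCard : ℂ) ^ (-(2 * z - 1)))⁻¹ := by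
  letI := Extension.fintype (𝓞 ↥(maximalRealSubfield L)) ↥(maximalRealSubfield L) L (𝓞 L) v
  have hq1 : (1 : ℝ) < residueFieldCard (v.adicCompletion ↥(maximalRealSubfield L)) := one_lt_residueFieldCard_real
  have hq0 : (0 : ℝ) < residueFieldCard (v.adicCompletion ↥(maximalRealSubfield L)) := one_pos.trans hq1
  have hq0' : (residueFieldCard (v.adicCompletion ↥(maximalRealSubfield L)) : ℂ) ≠ 0 := by exact_mod_cast hq0.ne'
  have hqR : (residueFieldCard (v.adicCompletion ↥(maximalRealSubfield L)) : ℂ) = ((residueFieldCard (v.adicCompletion ↥(maximalRealSubfield L)) : ℝ) : ℂ) := by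
    push_cast; rfl
  -- the datum `τ = e · q^{−2z}`, `‖τ‖ ≤ q^{−2 Re z} < q⁻¹`
  have hτ : ‖e * (residueFieldCard (v.adicCompletion ↥(maximalRealSubfield L)) : ℂ) ^ (-(2 * z))‖ <
      (residueFieldCard (v.adicCompletion ↥(maximalRealSubfield L)) : ℝ)⁻¹ := by
    rw [norm_mul, hqR, Complex.norm_cpow_eq_rpow_re_of_pos hq0, Complex.neg_re, ← Real.rpow_neg_one]
    have h2 : (2 * z).re = 2 * z.re := by simp [Complex.mul_re]
    calc ‖e‖ * (residueFieldCard (v.adicCompletion ↥(maximalRealSubfield L)) : ℝ) ^ (-(2 * z).re)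
        ≤ 1 * (residueFieldCard (v.adicCompletion ↥(maximalRealSubfield L)) : ℝ) ^ (-(2 * z).re) :=
          mul_le_mul_of_nonneg_right he (Real.rpow_nonneg hq0.le _)
      _ < (residueFieldCard (v.adicCompletion ↥(maximalRealSubfield L)) : ℝ) ^ (-1 : ℝ) := by
          rw [one_mul]; exact Real.rpow_lt_rpow_of_exponent_lt hq1 (by rw [h2]; linarith)
  -- the shell engine
  have h := integrable_and_integral_eq_of_shells μ
    (fun t : v.adicCompletion ↥(maximalRealSubfield L) => ω t * ((((∏ w : v.Extension (𝓞 L), max 1 (normAbs (w.1.adicCompletion L) (Extension.adicCompletionSemialgHom ↥(maximalRealSubfield L) L w t) * normAbs (w.1.adicCompletion L) ((algebraMap L (FiniteAdeleRing (𝓞 L) L) δ) w.1))) : ℝ≥0) : ℝ) : ℂ) ^ (-z)) hτ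
    (fun t ht => by
      have ht' : t ∈ v.adicCompletionIntegers ↥(maximalRealSubfield L) := (mem_primePowBall_zero_iff t).1 ht
      show ω t * _ = 1
      rw [hω0 t ht', prod_extension_max_one_eq_one_of_mem_integers (E := L) v hv ht', NNReal.coe_one, Complex.ofReal_one, Complex.one_cpow, one_mul])
    (fun m t ht => by
      show ω t * _ = _
      have hsq : ((residueFieldCard (v.adicCompletion ↥(maximalRealSubfield L)) : ℂ) ^ (-z)) ^ 2 =
          (residueFieldCard (v.adicCompletion ↥(maximalRealSubfield L)) : ℂ) ^ (-(2 * z)) := by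
        rw [← Complex.cpow_nat_mul]; congr 1; push_cast; ring
      rw [hωS m t ht, prod_extension_max_one_eq_sq (E := L) v hv t, NNReal.coe_pow, NNReal.coe_max, NNReal.coe_one, coe_normAbs_of_mem_outerShell ht,
        max_eq_right (one_le_pow₀ hq1.le), ← pow_mul,
        Summit.HodgeConjecture.HodgeConjecture.Cruxes.HLiu418.K2LiuGKRankOneIntegral.ofReal_pow_cpow ((m + 1) * 2) (-z), mul_comm (m + 1) 2, pow_mul, hsq, mul_pow])
  refine ⟨h.1, ?_⟩
  -- `μ(𝒪) = μ.real (𝔭⁰) > 0` cancels; then `q · (e q^{−2z}) = e · q^{−(2z−1)}`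
  have hball : primePowBall (v.adicCompletion ↥(maximalRealSubfield L)) 0 = (v.adicCompletionIntegers ↥(maximalRealSubfield L) : Set (v.adicCompletion ↥(maximalRealSubfield L))) :=
    Set.ext fun x => mem_primePowBall_zero_iff x
  have hpos : 0 < μ.real (primePowBall (v.adicCompletion ↥(maximalRealSubfield L)) 0) := measureReal_primePowBall_pos μ 0
  rw [h.2, ← mul_assoc, show (μ (v.adicCompletionIntegers ↥(maximalRealSubfield L))).toReal = μ.real (primePowBall (v.adicCompletion ↥(maximalRealSubfield L)) 0) by
      rw [Measure.real, hball], ← Complex.ofReal_mul, inv_mul_cancel₀ hpos.ne', Complex.ofReal_one, one_mul, residueFieldCard_adicCompletion_eq, div_eq_mul_inv]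
  congr 2
  rw [residueFieldCard_adicCompletion_eq] at hq0'
  rw [mul_left_comm, show -(2 * z - 1) = -(2 * z) + 1 by ring, Complex.cpow_add _ _ hq0', Complex.cpow_one, mul_comm ((v.residueCard : ℂ) ^ (-(2 * z))) (v.residueCard : ℂ)]

end Shells

end Summit.HodgeConjecture.HodgeConjecture.Cruxes.H413.K2E1ChiLocalWeightNonsplitU2

end
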